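import Mathlib.LinearAlgebra.Matrix.PosDef
import Mathlib.Analysis.Matrix.Order
import Mathlib.Data.Matrix.ColumnRowPartitioned
import Mathlib.Algebra.Star.Pi
import HarnessLib

/-!
# Ventures/CertifiedQuantumChemistry — Rows/KernelFacialReduction.lean: index-dropping facial
# reduction of a PSD block by a KNOWN kernel

HONEST FRAMING (verbatim): certified bounds for a stated model Hamiltonian in a stated basis; not a
claim about the real molecule beyond that model.

Seat rdm-B (gen 29), zero compute; a courtesy file of the X∞ structure ladder (no row, no claim node,
nothing asserted about any model). It types the elementary lemma behind the facially reduced leg-F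
vehicles `orbD<L>f` of `pub-qchem-rdmb/ab-files/v56/face/` (METHOD NOTE X∞-F/FACE,
`pub-qchem-rdmb/tools/narrow-g29/METHOD-NOTE.md` §3) and behind the structural-face remark of
`Rows/GMatrixSectorKernel.lean`:

  if `B` is Hermitian, `B * W = 0`, and the rows of `W` indexed by the DROPPED set `T` form an
  invertible square matrix, then `B ⪰ 0 ⟺ B[S,S] ⪰ 0` for the KEPT set `S` (the complement of `T`).

Reason: `[e_S | W]` is a basis, congruence by it turns `B` into `diag(B[S,S], 0)`. The file proves it
vector-wise (no determinant): every `x` decomposes as `x = s + u` with `u ∈ range W ⊆ ker B` and `s`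
supported on `S`, and for Hermitian `B` the quadratic form only sees `s`
(`star_dotProduct_mulVec_add_of_mulVec_eq_zero`). Consequences for the cell's SDP vehicles (words, not
Lean): once the structural rows `B(z) W = 0` are imposed as equalities, the PSD constraint on `B(z)` may be
replaced by the PSD constraint on its principal submatrix `B(z)[S,S]`, with the same feasible set; the
physical anchor then is a Slater point. Everything is PROVED (0 sorry); typeclass generality = any
`CommRing` with a compatible star order (covers `ℝ`, `ℚ`, `ℂ`).
-/

namespace Summit.Ventures.CertifiedQuantumChemistry

open Matrix

variable {R : Type*} [CommRing R] [StarRing R]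

/-- For a Hermitian `B` and a kernel vector `u` (`B u = 0`), the quadratic form does not see `u`:
`(x + u)ᴴ B (x + u) = xᴴ B x`. [folklore] -/
theorem star_dotProduct_mulVec_add_of_mulVec_eq_zero {n : Type*} [Fintype n]
    {B : Matrix n n R} (hB : B.IsHermitian) {u : n → R} (hu : B *ᵥ u = 0) (x : n → R) :
    star (x + u) ⬝ᵥ (B *ᵥ (x + u)) = star x ⬝ᵥ (B *ᵥ x) := by
  have hu' : star u ᵥ* B = 0 := by
    have h := congrArg star hu
    rw [star_mulVec, hB.eq, star_zero] at h
    exact h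
  rw [mulVec_add, hu, add_zero, star_add, add_dotProduct, dotProduct_mulVec (star u), hu',
    zero_dotProduct, add_zero]

/-- The `(1,1)` block of a `Sum`-indexed square matrix is its principal submatrix on `Sum.inl`.
[folklore] -/
theorem toBlocks₁₁_eq_submatrix {S T α : Type*} (B : Matrix (S ⊕ T) (S ⊕ T) α) :
    B.toBlocks₁₁ = B.submatrix Sum.inl Sum.inl := rfl

/-- The quadratic form of `B` at a vector supported on the kept block `S` is the quadratic form of the
principal submatrix `B.toBlocks₁₁`. [folklore] -/
theorem star_sumElim_zero_dotProduct_mulVec {S T : Type*} [Fintype S] [Fintype T]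
    (B : Matrix (S ⊕ T) (S ⊕ T) R) (v : S → R) :
    star (Sum.elim v 0) ⬝ᵥ (B *ᵥ Sum.elim v 0) = star v ⬝ᵥ (B.toBlocks₁₁ *ᵥ v) := by
  have hstar : star (Sum.elim v (0 : T → R)) = Sum.elim (star v) 0 := by
    rw [Function.star_sumElim, star_zero]
  conv_lhs => rw [← fromBlocks_toBlocks B]
  rw [fromBlocks_mulVec, Sum.elim_comp_inl, Sum.elim_comp_inr, mulVec_zero, mulVec_zero, add_zero,
    add_zero, hstar, sumElim_dotProduct_sumElim, zero_dotProduct, add_zero]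

/-- INDEX-DROPPING FACIAL REDUCTION (block form). Let `B` be a Hermitian matrix indexed by
`S ⊕ T` (`S` = kept indices, `T` = dropped indices) and `W : Matrix (S ⊕ T) T R` with `B * W = 0`
whose `T`-rows `W.toRows₂` are invertible. Then `B` is positive semidefinite iff its principal
submatrix `B.toBlocks₁₁` on `S` is. (`[e_S | W]` is a basis in which `B` is `diag(B[S,S], 0)`.)
[folklore: facial reduction of a spectrahedron by a known kernel; e.g. Borwein–Wolkowicz 1981,
Permenter–Parrilo 2018 §2] -/
theorem posSemidef_iff_toBlocks₁₁_of_mul_eq_zero [PartialOrder R] {S T : Type*} [Fintype S] [Fintype T]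
    [DecidableEq T] {B : Matrix (S ⊕ T) (S ⊕ T) R} (hB : B.IsHermitian)
    {W : Matrix (S ⊕ T) T R} (hBW : B * W = 0) [Invertible W.toRows₂] :
    B.PosSemidef ↔ B.toBlocks₁₁.PosSemidef := by
  constructor
  · intro h
    rw [toBlocks₁₁_eq_submatrix]
    exact h.submatrix Sum.inl
  · intro hA
    refine PosSemidef.of_dotProduct_mulVec_nonneg hB fun x => ?_
    -- coefficients on the kernel vectors that cancel the `T`-part of `x`
    set t : T → R := ⅟(W.toRows₂) *ᵥ (fun i => x (Sum.inr i)) with ht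
    set u : S ⊕ T → R := W *ᵥ t with hu_def
    have hu : B *ᵥ u = 0 := by
      rw [hu_def, mulVec_mulVec, hBW, zero_mulVec]
    have hT : ∀ i : T, u (Sum.inr i) = x (Sum.inr i) := by
      intro i
      have h1 : u (Sum.inr i) = (W.toRows₂ *ᵥ t) i := rfl
      rw [h1, ht, mulVec_mulVec, mul_invOf_self, one_mulVec]
    set s : S ⊕ T → R := x - u with hs_def
    have hs : s = Sum.elim (fun j => s (Sum.inl j)) 0 := by
      funext i
      cases i with
      | inl j => rfl
      | inr i => simp [hs_def, hT i]
    have hx : x = s + u := by rw [hs_def, sub_add_cancel]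
    rw [hx, star_dotProduct_mulVec_add_of_mulVec_eq_zero hB hu, hs,
      star_sumElim_zero_dotProduct_mulVec]
    exact hA.dotProduct_mulVec_nonneg _

/-- INDEX-DROPPING FACIAL REDUCTION (general index type). For `B : Matrix m m R` Hermitian with
`B * W = 0`, any splitting `e : S ⊕ T ≃ m` of the indices into kept (`S`) and dropped (`T`) ones
such that the dropped rows of `W` are invertible gives `B ⪰ 0 ⟺ B[S,S] ⪰ 0`, where
`B[S,S] = B.submatrix (e ∘ inl) (e ∘ inl)`. This is the form used by the facially reduced
solver vehicles: drop `|T| = rank W` coordinates of the block, keep the kernel identities as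
equality rows. [folklore] -/
theorem posSemidef_iff_submatrix_of_mul_eq_zero [PartialOrder R] {S T m : Type*} [Fintype S]
    [Fintype T] [DecidableEq T] [Fintype m] {B : Matrix m m R} (hB : B.IsHermitian)
    {W : Matrix m T R} (hBW : B * W = 0) (e : S ⊕ T ≃ m) [Invertible (W.submatrix e id).toRows₂] :
    B.PosSemidef ↔ (B.submatrix (e ∘ Sum.inl) (e ∘ Sum.inl)).PosSemidef := by
  have hB' : (B.submatrix e e).IsHermitian := hB.submatrix e
  have hBW' : B.submatrix e e * W.submatrix e id = 0 := by
    rw [← submatrix_mul B W e e id e.bijective, hBW, submatrix_zero, Pi.zero_apply, Pi.zero_apply]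
  have key := posSemidef_iff_toBlocks₁₁_of_mul_eq_zero hB' hBW'
  rw [posSemidef_submatrix_equiv e] at key
  rw [key, toBlocks₁₁_eq_submatrix, submatrix_submatrix]

/-! ### Appendix (gen 29, same sitting): why the FACE ROWS are valid equalities
The facially reduced vehicles impose `B(y) w = 0` as linear rows. On the feasible set this is implied
by the rider: `structid` records that the diagonal form `w† B(y) w` is an affine combination of the
rider rows (so it VANISHES at every row-feasible `y`), and a positive semidefinite matrix whose
quadratic form vanishes at `w` has `w` in its kernel (Mathlib's
`Matrix.PosSemidef.dotProduct_mulVec_zero_iff`, over `RCLike` scalars). The abstract statement: -/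

section FaceRows

open scoped ComplexOrder

/-- FACE ROWS ARE IMPLIED. Let `Bof y` be the block at the variables `y`, `rows` the rider's affine
constraints, and `w` a vector whose diagonal form vanishes on the affine space (`hid`, the `structid`
identity "`w† B(·) w` reduces to `0` modulo the rider rows"). Then at every row-feasible `y` with
`Bof y ⪰ 0` the whole vector identity `B(y) w = 0` holds — so adding these rows to the programme does
not change its feasible set. [folklore] -/
theorem mulVec_eq_zero_of_face_identity {𝕜 : Type*} [RCLike 𝕜] {ι n : Type*} [Fintype n]
    (Bof : (ι → 𝕜) → Matrix n n 𝕜) (rows : (ι → 𝕜) → Prop) (w : n → 𝕜)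
    (hid : ∀ y, rows y → star w ⬝ᵥ (Bof y *ᵥ w) = 0) {y : ι → 𝕜} (hy : rows y)
    (hpsd : (Bof y).PosSemidef) : Bof y *ᵥ w = 0 :=
  (hpsd.dotProduct_mulVec_zero_iff w).mp (hid y hy)

/-- Conversely (trivially) the face rows imply the vanishing of the diagonal form, so on the PSD-feasible
set the two descriptions of the face coincide. [folklore] -/
theorem face_identity_iff_mulVec_eq_zero {𝕜 : Type*} [RCLike 𝕜] {n : Type*} [Fintype n]
    {B : Matrix n n 𝕜} (hpsd : B.PosSemidef) (w : n → 𝕜) :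
    star w ⬝ᵥ (B *ᵥ w) = 0 ↔ B *ᵥ w = 0 :=
  hpsd.dotProduct_mulVec_zero_iff w

end FaceRows

end Summit.Ventures.CertifiedQuantumChemistry
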